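import Mathlib
import HarnessLib
import Summits.HubbardSuperconductivity.HubbardSuperconductivity.Theorems.KLProgrammeKLRegimeEngineTowerWtLawOfBlocksKlEngUnif
import Summits.HubbardSuperconductivity.HubbardSuperconductivity.Theorems.KLProgrammeKLRegimeEngineTowerWtReadoutFitSharpUnif
import Summits.HubbardSuperconductivity.HubbardSuperconductivity.Theorems.KLProgrammeKLRegimeEngineTowerWtAssemblyKlEng
import Summits.HubbardSuperconductivity.HubbardSuperconductivity.Theorems.KLProgrammeKLRegimeEngineTowerBlockZeroBaseWtKlEngClosed
import Summits.HubbardSuperconductivity.HubbardSuperconductivity.Theorems.KLProgrammeKLRegimeEngineTowerParityUnits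
import Summits.HubbardSuperconductivity.HubbardSuperconductivity.Theorems.KLProgrammeKLRegimeKernelNormsLevelsDegreeCap

/-!
# ♯4 RE-THREAD, FILE C: «(b)-WT4-ASSEMBLY-∀j» WITH THE BASE DATUM DISCHARGED — «D-ORDER» CURED (the d-free constants BEFORE `∀ d`) AND THE SIX-LEG IMPORT
# AT BLOCK 1 DISCHARGED (♯4 item (ii), «(b)-WT4-6LEG-CURRENCY», pen (R416)(B)(2)); the three ♯3 cures (READOUT-CE-DIM, BLOCK0-RATE, E-b1-2LEG-SHAPE) kept
# Route `KLProgramme` — crux K3 ENGINE (stmt-HubbardSuperconductivity-20437 `KLRegimeEngineV17F2`), stub (b) v2, THE WEIGHTED HALF «(b)-WT4»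
# (cell gate-hubbard-kl, seat hubbard-kl-k3c3-p2 g18; = rows♯3 `kernelNormsWt4_all_klEng_rows_sharp3` (p710254) re-keyed on file A
#  `klTowerBornWtAt_le_law_of_blocks_klEng_tokX_unif` and file B `klWtPinnedSum_le_klWtBudget_of_wtLaw_klEng_sharp_unif`; E1 may rename or supersede)

WHAT CHANGES vs rows♯3 (everything else token-identical):
* «D-ORDER» (p4 g22, KL STATUS l.11984): the head reads `(R c″) : ∃ C₁ C₂ Cκ CJ C₁r C₂r Cκr CJr C₁i C₂i > 0, ∀ d, ∃ Cb Cbr > 0, ∃ Cinc₁ Dinc₁ ≥ 1,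
  ∃ Cκ₀ CJ₀ Cα > 0, (R.WF2 → …)` — the law's `C₂` and BOTH overlap constants `CJ CJr` (which pin `c̄c`, hence `Z` and the blocking row
  `2^{d−1} ≥ 8e⁴·Z·C₂²`) are in hand BEFORE the block length `d` is chosen; only the two alpha constants `Cb Cbr` and p3's block-0 constants follow `d`;
* ♯4 (ii): the six-leg IMPORT row is asked at blocks `k ≥ 2` only; at block `1` (`𝒱_d` at `(F_{d−1}, rate j)`) it is READ OFF p3's base law at `p = 3`
  (`klTowerMeasWtAt … d 1 j 6/klLevUnitF β M 0 3 (d−1) ≤ Ab·λ_j²·Qb³`, WB3 `baseLawWtF_blockZero_klEng_closed` once at `λ_d`, lifted) under ONE new domination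
  `W·Z³·(Ab·Qb³) ≤ ι₃` (numerics class, the shape of block 0's `W₀Z₀³Ab₀Qb₀³ ≤ ι₃₀`).
* **`kernelNormsWt4_all_klEng_rows_sharp4 (R c″)`** ⊢ `∀ j ≤ n, KernelNormsWt4 L M (klWtBudget P Qe U j) β U μ (klFlowFrameU L M β U μ n) j`.
File D (`…StructuralSharp4`) discharges the partition functions, the level 0, the two- and four-leg imports, the four-leg cells as structural♯3 did, takes the six-leg
CELLS as the sectorised `m = 6` clause itself and the six-leg imports at `k ≥ 2` as SECTORISED rows at the input family; files E/F as closed♯3/final♯3.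
Bookkeeping composition of landed theorems; nothing asserts (b), WT4's rows, (ℓ), any stub, K3 or superconductivity.
References: BGM 2006 §2.8 (2.76)–(2.84), (2.93)–(2.98), Lemma 2.5, §3 (3.2)–(3.8) [cite: BenfattoGiulianiMastropietro2006].
-/

noncomputable section

namespace Summit.HubbardSuperconductivity.HubbardSuperconductivity.Theorems.EngineV8

set_option linter.dupNamespace false -- summit = problem name (single-conjunct summit), D-0017

open Classical
open Real Finset Literature.MathematicalPhysics.QuantumLattice Literature.Probability.LatticeModels GrassmannAlgebra
open Literature.MathematicalPhysics.QuantumLattice.FermiRG Literature.MathematicalPhysics.QuantumLattice.FermiRG.BGM2006Routing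
open Summit.HubbardSuperconductivity.HubbardSuperconductivity.Theorems.KLProgrammeLegKernels
open Summit.HubbardSuperconductivity.HubbardSuperconductivity.Theorems.KLRegimeSplit
open Summit.HubbardSuperconductivity.HubbardSuperconductivity.Theorems.KLRegimeWick
open Summit.HubbardSuperconductivity.HubbardSuperconductivity.Theorems.TwoPointAssembly
open Summit.HubbardSuperconductivity.HubbardSuperconductivity.Theorems.DispersionFlow
open Summit.HubbardSuperconductivity.HubbardSuperconductivity.Theorems.TorusFourierL2

variable {L M : ℕ} [NeZero L] [NeZero M]

/-! ## The weighted clause at every level — base datum discharged, d-free constants first, six-leg import at block 1 discharged -/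

set_option maxHeartbeats 400000 in -- one ~220-binder composition instantiated per level (default × 2), as rows♯3
/-- **STUB (b)'s WEIGHTED CLAUSE ON THE FLOW FRAME — ASSEMBLY, BASE DATUM DISCHARGED, ♯4** («D-ORDER» cured: the d-free constants precede `∀ d`; the six-leg
import at block `1` read off the base law under `W·Z³·(Ab·Qb³) ≤ ι₃`, rows kept at `k ≥ 2`; the three ♯3 cures kept; see the module docstring);
conclusion `∀ j ≤ n, KernelNormsWt4 L M (klWtBudget P Qe U j) β U μ (klFlowFrameU L M β U μ n) j`.
[cite: BenfattoGiulianiMastropietro2006, §2.8 (2.76)-(2.84), (2.93)-(2.98), Lemma 2.5 (2.98), §3 (3.2)-(3.8)] -/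
theorem kernelNormsWt4_all_klEng_rows_sharp4 (R : RenConsts) (c'' : ℝ) (hc'' : 0 < c'') :
    ∃ C₁ C₂ Cκ CJ C₁r C₂r Cκr CJr C₁i C₂i : ℝ, 0 < C₁ ∧ 0 < C₂ ∧ 0 < Cκ ∧ 0 < CJ ∧
      0 < C₁r ∧ 0 < C₂r ∧ 0 < Cκr ∧ 0 < CJr ∧ 0 < C₁i ∧ 0 < C₂i ∧
      ∀ d : ℕ, ∃ Cb Cbr : ℝ, 0 < Cb ∧ 0 < Cbr ∧
      ∃ Cinc₁ Dinc₁ : ℝ, 1 ≤ Cinc₁ ∧ 1 ≤ Dinc₁ ∧ ∃ Cκ₀ CJ₀ Cα : ℝ, 0 < Cκ₀ ∧ 0 < CJ₀ ∧ 0 < Cα ∧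
      (R.WF2 → ∃ c₃' : ℝ, 0 < c₃' ∧ ∃ U₀' : ℝ, 0 < U₀' ∧
      ∀ (G : GeoConsts) (P : SplitConsts) (Q : EngConsts) (c : ℝ), P.WF → 0 < c → c ≤ klEngC₃6 P R → c ≤ c₃' →
      ∀ μ ∈ klWindowC, ∀ U : ℝ, 0 < U → U ≤ klEngU₀9 P R c → U ≤ U₀' → c'' * U ≤ 1 →
      ∀ β : ℝ, klBetaMin ≤ β → β ≤ Real.exp (c / U ^ 2) →
      ∀ (L M : ℕ) [NeZero L] [NeZero M], klEngL₃ β U ≤ L → klEngM₃ β U L ≤ M →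
      ∀ n : ℕ, 1 ≤ n → n ≤ nScales β + 1 → IsKLRegime U c (-(n : ℤ)) → HistP klPredsV17F2 L M G P Q R β U μ 0 n →
        (∀ m', 1 ≤ m' → m' < n → FlowPieceOscAt L M c'' β U μ m') →
      2 ≤ d → d ≤ n →
      -- the degree caps [choice: `exists_degreeCap`] (+ block `0`'s input family `F_0`)
      ∀ D : ℕ, 3 ≤ D → (∀ k, 1 ≤ k → d * k ≤ n → Fintype.card (SpaceTimeIdx L M × SectorLeg (sectorCount (d * k - 1))) / 2 ≤ D) →
        Fintype.card (HubbardFieldIdx L M) ≤ 2 * D + 1 → Fintype.card (SpaceTimeIdx L M × SectorLeg (sectorCount 0)) / 2 ≤ D →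
      -- the coupling amplitude and the law's constants
      ∀ (B A Q' Ab Qb : ℝ), 1 ≤ B → 0 ≤ A → 0 < Q' → 0 ≤ Ab → 0 ≤ Qb →
      -- BLOCK 0 (p3 WB3): the two partition functions, the block-0 names, the level-0 weighted datum of `𝒱_1` at `(F_0, rate j)`, block 0's numerics
      hubbardEffPartitionFnCT L M β U μ 0 (klFlowFrameU L M β U μ n) (klScale klE0 1) ≠ 0 →
      hubbardEffPartitionFnCT L M β U μ 0 (klFlowFrameU L M β U μ n) (klScale klE0 d) ≠ 0 →
      ∀ (Ab₀ Qb₀ : ℝ), 0 ≤ Ab₀ → 0 ≤ Qb₀ →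
      ∀ (αb₀ κb₀ crb₀ ccb₀ W₀ Z₀ σ₀ τ₀ ψ₀ Φ₀ : ℝ), αb₀ = Cα * ((M : ℝ) / β) → κb₀ = Real.sqrt (2 * Cκ₀ * klE0) → crb₀ = 81 * CJ₀ * M / β →
        ccb₀ = 162 * CJ₀ * M / β → W₀ = 32 * crb₀ / ccb₀ → Z₀ = imagTimeWeight β M ^ 2 * ccb₀ ^ 2 / 8 → σ₀ = κb₀ ^ 2 / ccb₀ ^ 2 →
        τ₀ = 4 * exp 4 * κb₀ ^ 2 / ccb₀ ^ 2 → ψ₀ = ccb₀ ^ 2 / κb₀ ^ 2 → Φ₀ = exp 1 * αb₀ * ccb₀ / (κb₀ ^ 2 * crb₀) →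
      ∀ (A'₀ Q'₀ ι₁₀ ι₂₀ ι₃₀ : ℝ), 0 ≤ A'₀ → 0 < Q'₀ →
      (∀ j, d ≤ j → j ≤ n → ∀ p : ℕ, 3 ≤ p →
        klTowerMeasWtAt L M β U μ (klFlowFrameU L M β U μ n) 1 1 j (2 * p) / klLevUnitF β M 0 p 0 ≤ Ab₀ * (B * epsCoupling P U d) ^ (p - 1) * Qb₀ ^ p) →
      (∀ j, d ≤ j → j ≤ n →
        (∀ m, 4 ≤ m → m ≤ D → W₀ * Z₀ ^ m * (klTowerMeasWtAt L M β U μ (klFlowFrameU L M β U μ n) 1 1 j (2 * m) / klLevUnitF β M 0 m 0) ≤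
          A'₀ * (B * epsCoupling P U d) ^ (m - 1) * Q'₀ ^ m) ∧
        W₀ * Z₀ ^ 3 * (klTowerMeasWtAt L M β U μ (klFlowFrameU L M β U μ n) 1 1 j (2 * 3) / klLevUnitF β M 0 3 0) ≤ ι₃₀ * (B * epsCoupling P U d) ^ 2 ∧
        W₀ * Z₀ ^ 1 * (klTowerMeasWtAt L M β U μ (klFlowFrameU L M β U μ n) 1 1 j (2 * 1) / klLevUnitF β M 0 1 0) ≤ ι₁₀ * (B * epsCoupling P U d) ∧
        W₀ * Z₀ ^ 2 * (klTowerMeasWtAt L M β U μ (klFlowFrameU L M β U μ n) 1 1 j (2 * 2) / klLevUnitF β M 0 2 0) ≤ ι₂₀ * (B * epsCoupling P U d) ∧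
        4 * σ₀ * (B * epsCoupling P U d) * Q'₀ < 1 ∧ 2 * (B * epsCoupling P U d) * τ₀ * Q'₀ ≤ 1 ∧ exp 1 * τ₀ * (B * epsCoupling P U d) * Q'₀ < 1 ∧
        Φ₀ * (τ₀ * (ι₁₀ * (B * epsCoupling P U d) + ι₂₀ / (2 * Q'₀) + ι₃₀ / (4 * Q'₀ ^ 2) + A'₀ * Q'₀ / 4)) < 1 ∧
        Φ₀ * (exp 1 * τ₀ * (ι₁₀ * (B * epsCoupling P U d)) + (exp 1 * τ₀) ^ 2 * (ι₂₀ * (B * epsCoupling P U d)) +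
          (exp 1 * τ₀) ^ 3 * (ι₃₀ * (B * epsCoupling P U d) ^ 2) +
          A'₀ * (exp 1 * τ₀ * Q'₀) * ((exp 1 * τ₀ * (B * epsCoupling P U d) * Q'₀) ^ 3 / (1 - exp 1 * τ₀ * (B * epsCoupling P U d) * Q'₀))) < 1 ∧
        Φ₀ * towerV D τ₀ (fun m => W₀ * Z₀ ^ m *
          (klTowerMeasWtAt L M β U μ (klFlowFrameU L M β U μ n) 1 1 j (2 * m) / klLevUnitF β M 0 m 0)) < 1) →
      ∀ (Aro₁ Qro₁ Qtot₁ Atot₁ : ℝ), Aro₁ = Cinc₁ * Ab₀ → Qro₁ = Dinc₁ * Qb₀ →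
        Qtot₁ = Dinc₁ * max 1 (max Qro₁ (max (4 * Q'₀) (2 * τ₀ * ψ₀ * Q'₀))) →
        (Atot₁ = Aro₁ + Cinc₁ * (A'₀ * (4 * σ₀ * (B * epsCoupling P U d) * Q'₀ / (1 - 4 * σ₀ * (B * epsCoupling P U d) * Q'₀)) +
          exp 1 * (τ₀ * (ι₁₀ * (B * epsCoupling P U d) + ι₂₀ / (2 * Q'₀) + ι₃₀ / (4 * Q'₀ ^ 2) + A'₀ * Q'₀ / 4)) *
            (Φ₀ * (τ₀ * (ι₁₀ * (B * epsCoupling P U d) + ι₂₀ / (2 * Q'₀) + ι₃₀ / (4 * Q'₀ ^ 2) + A'₀ * Q'₀ / 4)) /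
              (1 - Φ₀ * (τ₀ * (ι₁₀ * (B * epsCoupling P U d) + ι₂₀ / (2 * Q'₀) + ι₃₀ / (4 * Q'₀ ^ 2) + A'₀ * Q'₀ / 4)))) / (2 * τ₀ * Q'₀))) →
        (d ≤ n → Atot₁ ≤ Ab) → Qtot₁ = Qb →
      -- dominants of the LINK's and of the read-out's constants, and the names
      ∀ (κb αb crb ccb : ℝ), Real.sqrt (2 * Cκ * klE0) ≤ κb → Cb * ((M : ℝ) / β) * (4 : ℝ) ^ d / klE0 ≤ αb →
        81 * CJ * M / β ≤ crb → 162 * CJ * M / β ≤ ccb →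
        Real.sqrt (2 * Cκr * klE0) ≤ κb → Cbr * ((M : ℝ) / β) * (4 : ℝ) ^ d / klE0 ≤ αb → 81 * CJr * M / β ≤ crb → 162 * CJr * M / β ≤ ccb →
      ∀ (W Z σ τ ψ Φ : ℝ),
        W = 32 * crb / ccb → Z = imagTimeWeight β M ^ 2 * ccb ^ 2 / 8 →
        σ = κb ^ 2 / ccb ^ 2 → τ = 4 * exp 4 * κb ^ 2 / ccb ^ 2 → ψ = ccb ^ 2 / κb ^ 2 → Φ = exp 1 * αb * ccb / (κb ^ 2 * crb) →
      ∀ (A' Q'' : ℝ),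
        W * ((C₁ / C₂) * (8 : ℝ) ^ (d - 1) * (Ab + A / (1 - ((2 : ℝ) ^ d)⁻¹))) ≤ A' →
        Z * (C₂ ^ 2 * ((2 : ℝ) ^ (d - 1))⁻¹ * max Q' Qb) ≤ Q'' → W * Ab ≤ A' → Z * Qb ≤ Q'' → 0 < Q'' →
      -- the weighted two- and four-leg imports at every block `d·k ≤ j`, every rate `d ≤ j ≤ n` [E1 via k3c2-p3]; the two-leg amplitude `ι₁ j` is RATE-INDEXED («E-b1-2LEG-SHAPE»)
      ∀ (ι₁ : ℕ → ℝ) (ι₂ ι₃ : ℝ),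
      (∀ j, d ≤ j → j ≤ n → ∀ k, 1 ≤ k → d * k ≤ j → W * Z ^ 1 *
        (klTowerMeasWtAt L M β U μ (klFlowFrameU L M β U μ n) d k j (2 * 1) / klLevUnitF β M 0 1 (d * k - 1)) ≤ ι₁ j * (B * epsCoupling P U j)) →
      (∀ j, d ≤ j → j ≤ n → ∀ k, 1 ≤ k → d * k ≤ j → W * Z ^ 2 *
        (klTowerMeasWtAt L M β U μ (klFlowFrameU L M β U μ n) d k j (2 * 2) / klLevUnitF β M 0 2 (d * k - 1)) ≤ ι₂ * (B * epsCoupling P U j)) →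
      -- the six-leg import: block `1` is DISCHARGED here from p3's base law at `p = 3` under ONE domination; blocks `k ≥ 2` stay rows (♯4 (ii), sectorised in file D)
      W * Z ^ 3 * (Ab * Qb ^ 3) ≤ ι₃ →
      (∀ j, d ≤ j → j ≤ n → ∀ k, 2 ≤ k → d * k ≤ j → W * Z ^ 3 *
        (klTowerMeasWtAt L M β U μ (klFlowFrameU L M β U μ n) d k j (2 * 3) / klLevUnitF β M 0 3 (d * k - 1)) ≤ ι₃ * (B * epsCoupling P U j) ^ 2) →
      -- the kit's numerics at every read-out rate [p4 «part 4»]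
      (∀ j, d ≤ j → j ≤ n →
        4 * σ * (B * epsCoupling P U j) * Q'' < 1 ∧ 2 * (B * epsCoupling P U j) * τ * Q'' ≤ 1 ∧ exp 1 * τ * (B * epsCoupling P U j) * Q'' < 1 ∧
        Φ * (τ * (ι₁ j * (B * epsCoupling P U j) + ι₂ / (2 * Q'') + ι₃ / (4 * Q'' ^ 2) + A' * Q'' / 4)) < 1 ∧
        Φ * (exp 1 * τ * (ι₁ j * (B * epsCoupling P U j)) + (exp 1 * τ) ^ 2 * (ι₂ * (B * epsCoupling P U j)) +
          (exp 1 * τ) ^ 3 * (ι₃ * (B * epsCoupling P U j) ^ 2) +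
          A' * (exp 1 * τ * Q'') * ((exp 1 * τ * (B * epsCoupling P U j) * Q'') ^ 3 / (1 - exp 1 * τ * (B * epsCoupling P U j) * Q''))) < 1 ∧
        4 * Q'' ≤ Q' ∧ 2 * τ * ψ * Q'' ≤ Q' ∧
        A' * (4 * Q'') ^ 3 * (4 * σ * (B * epsCoupling P U j) * Q'' / (1 - 4 * σ * (B * epsCoupling P U j) * Q'')) +
          exp 1 * ψ * (2 * τ * ψ * Q'') ^ 2 * (τ * (ι₁ j * (B * epsCoupling P U j) + ι₂ / (2 * Q'') + ι₃ / (4 * Q'' ^ 2) + A' * Q'' / 4)) *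
            (Φ * (τ * (ι₁ j * (B * epsCoupling P U j) + ι₂ / (2 * Q'') + ι₃ / (4 * Q'' ^ 2) + A' * Q'' / 4)) /
              (1 - Φ * (τ * (ι₁ j * (B * epsCoupling P U j) + ι₂ / (2 * Q'') + ι₃ / (4 * Q'' ^ 2) + A' * Q'' / 4)))) ≤ A * Q' ^ 3) →
      -- the read-out constants level by level and the budget package's `CE` row [p4]
      ∀ (Qe : EngConsts) (Atot Qtot : ℕ → ℝ),
        (∀ j, Qtot j = max 1 (C₂i ^ 2) * max 1 (max (C₂r ^ 2 * max Q' Qb) (max (4 * Q'') (2 * τ * ψ * Q'')))) →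
        (∀ j, Atot j = C₁r / C₂r * (Ab + A) + C₁i / C₂i * (A' * (4 * σ * (B * epsCoupling P U j) * Q'' / (1 - 4 * σ * (B * epsCoupling P U j) * Q'')) +
          exp 1 * (τ * (ι₁ j * (B * epsCoupling P U j) + ι₂ / (2 * Q'') + ι₃ / (4 * Q'' ^ 2) + A' * Q'' / 4)) *
            (Φ * (τ * (ι₁ j * (B * epsCoupling P U j) + ι₂ / (2 * Q'') + ι₃ / (4 * Q'' ^ 2) + A' * Q'' / 4)) /
              (1 - Φ * (τ * (ι₁ j * (B * epsCoupling P U j) + ι₂ / (2 * Q'') + ι₃ / (4 * Q'' ^ 2) + A' * Q'' / 4)))) / (2 * τ * Q''))) →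
        (∀ j, d ≤ j → j ≤ n → Qtot j * imagTimeWeight β M ^ 2 * B * max 1 (Atot j / imagTimeWeight β M) ≤ Qe.CE) → 0 ≤ Qe.CE →
      -- the two import cells at every level [E1 via k3c2-p3 `klWtPinnedSum_four/_six_le_of_wplain_flow_all`] and the low levels [p3 block-0 class]
      (∀ j, j ≤ n → ∀ (q : Fin 4) (w : SpaceTimeIdx L M × SectorLeg (sectorCount j)),
        klWtPinnedSum L M β U μ (klFlowFrameU L M β U μ n) j 4 q w ≤ klWtBudget P Qe U j 4) →
      (∀ j, j ≤ n → ∀ (q : Fin 6) (w : SpaceTimeIdx L M × SectorLeg (sectorCount j)),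
        klWtPinnedSum L M β U μ (klFlowFrameU L M β U μ n) j 6 q w ≤ klWtBudget P Qe U j 6) →
      (∀ j, j < d → j ≤ n → KernelNormsWt4 L M (klWtBudget P Qe U j) β U μ (klFlowFrameU L M β U μ n) j) →
      ∀ j, j ≤ n → KernelNormsWt4 L M (klWtBudget P Qe U j) β U μ (klFlowFrameU L M β U μ n) j) := by
  obtain ⟨C₁, C₂, Cκ, CJ, hC₁, hC₂, hCκ, hCJ, hlawU⟩ := klTowerBornWtAt_le_law_of_blocks_klEng_tokX_unif R c'' hc''
  obtain ⟨C₁r, C₂r, Cκr, CJr, C₁i, C₂i, hC₁r, hC₂r, hCκr, hCJr, hC₁i, hC₂i, hfitU⟩ := klWtPinnedSum_le_klWtBudget_of_wtLaw_klEng_sharp_unif R c'' hc''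
  refine ⟨C₁, C₂, Cκ, CJ, C₁r, C₂r, Cκr, CJr, C₁i, C₂i, hC₁, hC₂, hCκ, hCJ, hC₁r, hC₂r, hCκr, hCJr, hC₁i, hC₂i, fun d => ?_⟩
  obtain ⟨Cb, hCb, hlaw⟩ := hlawU d
  obtain ⟨Cbr, hCbr, hfit⟩ := hfitU d
  obtain ⟨Cinc₁, Dinc₁, hCinc₁, hDinc₁, Cκ₀, CJ₀, Cα, hCκ₀, hCJ₀, hCα, hbase⟩ := baseLawWtF_blockZero_klEng_closed d R c'' hc''
  refine ⟨Cb, Cbr, hCb, hCbr, Cinc₁, Dinc₁, hCinc₁, hDinc₁, Cκ₀, CJ₀, Cα, hCκ₀, hCJ₀, hCα, fun hR2 => ?_⟩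
  obtain ⟨c₃a, hc₃a, U₀a, hU₀a, hlaw'⟩ := hlaw hR2
  obtain ⟨c₃b, hc₃b, U₀b, hU₀b, hfit'⟩ := hfit hR2
  obtain ⟨c₃c, hc₃c, U₀c, hU₀c, hbase'⟩ := hbase hR2
  refine ⟨min c₃a (min c₃b c₃c), lt_min hc₃a (lt_min hc₃b hc₃c), min U₀a (min U₀b U₀c), lt_min hU₀a (lt_min hU₀b hU₀c), ?_⟩
  intro G P Q c hP hc hc6 hc₃' μ hμ U hU hU9 hU₀' hcU β hβmin hβc L M _ _ hL3 hM3 n hn1 hnN hkl hhist hosc hd hdn D hD3 hD hcard hD0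
    B A Q' Ab Qb hB hA hQ hAb hQb hZ1 hZd Ab₀ Qb₀ hAb₀ hQb₀ αb₀ κb₀ crb₀ ccb₀ W₀ Z₀ σ₀ τ₀ ψ₀ Φ₀ hαb₀ hκb₀ hcrb₀ hccb₀ hW₀ hZ₀ hσ₀ hτ₀ hψ₀ hΦ₀
    A'₀ Q'₀ ι₁₀ ι₂₀ ι₃₀ hA'₀ hQ'₀ hlawb₀ hblk0 Aro₁ Qro₁ Qtot₁ Atot₁ hAro₁ hQro₁ hQtot₁ hAtot₁ hAtotle hQtotQb
    κb αb crb ccb hκb hαb hcrb hccb hκbr hαbr hcrbr hccbr W Z σ τ ψ Φ hW hZ' hσ hτ hψ hΦ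
    A' Q'' hA'1 hQ'1 hA'2 hQ'2 hQ'0 ι₁ ι₂ ι₃ hι₁ hι₂ hdomι₃ hι₃ hnum Qe Atot Qtot hQtot hAtot hCE hCE0 hcell4 hcell6 hlow j hjn
  have hc₃a' : c ≤ c₃a := hc₃'.trans (min_le_left _ _)
  have hc₃b' : c ≤ c₃b := hc₃'.trans ((min_le_right _ _).trans (min_le_left _ _))
  have hc₃c' : c ≤ c₃c := hc₃'.trans ((min_le_right _ _).trans (min_le_right _ _))
  have hU₀a' : U ≤ U₀a := hU₀'.trans (min_le_left _ _)
  have hU₀b' : U ≤ U₀b := hU₀'.trans ((min_le_right _ _).trans (min_le_left _ _))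
  have hU₀c' : U ≤ U₀c := hU₀'.trans ((min_le_right _ _).trans (min_le_right _ _))
  have hβ : 0 < β := KLRegimeSplit.pos_of_klBetaMin_le hβmin
  have hK1 : 1 ≤ P.Klam := hP.1
  have hKl : 0 ≤ P.Klam := le_trans zero_le_one hK1
  have hfr : FrameOK R U (nScales β) μ (klFlowFrameU L M β U μ n) := frameOK_klFlowFrameU_of_histP_le hR2 hn1 le_rfl hnN hhist
  set K : TrigPolyC4v := klFlowFrameU L M β U μ n with hKdef
  -- the base rows of `𝒱_d` at `(F_{d−1}, rate j)` from p3's WB2/WB3, run ONCE at the fixed coupling `λ_d` («(b)-WT4-BLOCK0-RATE» cure) and lifted to `λ_j`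
  set Nb : ℕ → ℕ → ℝ := fun j p => klTowerMeasWtAt L M β U μ K d 1 j (2 * p) with hNb
  have hNb0 : ∀ j p, 0 ≤ Nb j p := fun j p => (klTowerMeasWtAt_one_baseRowsW hβ.le U μ K d j).1 p
  have hcar : ∀ j, d ≤ j → j ≤ n → ∀ (p : ℕ) (q : Fin (2 * p)) (w' : SpaceTimeIdx L M × SectorLeg (sectorCount (d - 1))),
      klWtPinnedSumAt L M β μ K (d - 1) j (2 * p) (klTowerInput L M β U μ K d 1) q w' ≤ Nb j p :=
    fun j _ _ p q w' => (klTowerMeasWtAt_one_baseRowsW hβ.le U μ K d j).2 p q w'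
  have hlawb : ∀ j, d ≤ j → j ≤ n → ∀ p : ℕ, 3 ≤ p → Nb j p / klLevUnitF β M 0 p (d - 1) ≤ Ab * (B * epsCoupling P U j) ^ (p - 1) * Qb ^ p := by
    intro j hjd hjn p hp
    have hεpos : 0 < epsCoupling P U d := by
      unfold epsCoupling; have : 0 < P.Klam := by linarith
      positivity
    have hlam : 0 < B * epsCoupling P U d := by positivity
    have hεmono : epsCoupling P U d ≤ epsCoupling P U j := by
      unfold epsCoupling
      exact mul_le_mul_of_nonneg_left ((add_le_add_iff_left |U|).2 (mul_le_mul_of_nonneg_left (Nat.cast_le.2 hjd) (sq_nonneg U))) hKl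
    have hlle : B * epsCoupling P U d ≤ B * epsCoupling P U j := mul_le_mul_of_nonneg_left hεmono (zero_le_one.trans hB)
    obtain ⟨hprof₀, hprof3₀, himp₁₀, himp₂₀, hx₁₀, hx₂₀, hx₃₀, hy₀, hθ₀, hguard₀⟩ := hblk0 j hjd hjn
    have h := hbase' G P Q c hP hc hc6 hc₃c' μ hμ U hU hU9 hU₀c' hcU β hβmin hβc L M hL3 hM3 n hn1 hnN hkl hhist hfr hosc hd hdn hZ1 j D (by omega) hD0
      (B * epsCoupling P U d) Ab₀ Qb₀ hlam hAb₀ hQb₀ αb₀ κb₀ crb₀ ccb₀ W₀ Z₀ σ₀ τ₀ ψ₀ Φ₀ hαb₀ hκb₀ hcrb₀ hccb₀ hW₀ hZ₀ hσ₀ hτ₀ hψ₀ hΦ₀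
      A'₀ Q'₀ ι₁₀ ι₂₀ ι₃₀ hA'₀ hQ'₀ (hlawb₀ j hjd hjn) hprof₀ hprof3₀ himp₁₀ himp₂₀ hx₁₀ hx₂₀ hx₃₀ hy₀ hθ₀ hguard₀ Aro₁ Qro₁ Qtot₁ Atot₁
      hAro₁ hQro₁ hQtot₁ hAtot₁ p hp
    refine h.trans ?_
    rw [hQtotQb]
    calc Atot₁ * (B * epsCoupling P U d) ^ (p - 1) * Qb ^ p ≤ Ab * (B * epsCoupling P U d) ^ (p - 1) * Qb ^ p :=
          mul_le_mul_of_nonneg_right (mul_le_mul_of_nonneg_right (hAtotle hdn) (pow_nonneg hlam.le _)) (pow_nonneg hQb _)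
      _ ≤ Ab * (B * epsCoupling P U j) ^ (p - 1) * Qb ^ p :=
          mul_le_mul_of_nonneg_right (mul_le_mul_of_nonneg_left (pow_le_pow_left₀ hlam.le hlle _) hAb) (pow_nonneg hQb _)
  -- ♯4 (ii): block 1's six-leg import from the base law at `p = 3` and the domination `W·Z³·(Ab·Qb³) ≤ ι₃`; blocks `k ≥ 2` from the rows
  have hM0 : (0 : ℝ) < M := Nat.cast_pos.2 (Nat.pos_of_ne_zero (NeZero.ne M))
  have hcrb0 : 0 < crb := lt_of_lt_of_le (by positivity) hcrb
  have hccb0 : 0 < ccb := lt_of_lt_of_le (by positivity) hccb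
  have hW0' : 0 ≤ W := by rw [hW]; positivity
  have hZ0' : 0 ≤ Z := by rw [hZ']; positivity
  have hι₃all : ∀ j, d ≤ j → j ≤ n → ∀ k, 1 ≤ k → d * k ≤ j → W * Z ^ 3 *
      (klTowerMeasWtAt L M β U μ K d k j (2 * 3) / klLevUnitF β M 0 3 (d * k - 1)) ≤ ι₃ * (B * epsCoupling P U j) ^ 2 := by
    intro j hjd hjn k hk1 hkj
    rcases Nat.lt_or_ge k 2 with hk | hk
    · obtain rfl : k = 1 := by omega
      have hlam0 : 0 ≤ B * epsCoupling P U j := mul_nonneg (zero_le_one.trans hB) (epsCoupling_nonneg' hKl U j)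
      have h3 : klTowerMeasWtAt L M β U μ K d 1 j (2 * 3) / klLevUnitF β M 0 3 (d * 1 - 1) ≤ Ab * (B * epsCoupling P U j) ^ 2 * Qb ^ 3 := by
        rw [Nat.mul_one]; exact hlawb j hjd hjn 3 le_rfl
      calc W * Z ^ 3 * (klTowerMeasWtAt L M β U μ K d 1 j (2 * 3) / klLevUnitF β M 0 3 (d * 1 - 1))
          ≤ W * Z ^ 3 * (Ab * (B * epsCoupling P U j) ^ 2 * Qb ^ 3) := mul_le_mul_of_nonneg_left h3 (by positivity)
        _ = W * Z ^ 3 * (Ab * Qb ^ 3) * (B * epsCoupling P U j) ^ 2 := by ring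
        _ ≤ ι₃ * (B * epsCoupling P U j) ^ 2 := mul_le_mul_of_nonneg_right hdomι₃ (pow_nonneg hlam0 2)
    · exact hι₃ j hjd hjn k hk hkj
  -- low levels: a row
  rcases Nat.lt_or_ge j d with hjd | hjd
  · exact hlow j hjd hjn
  -- `d ≤ j`: the block count `K_b := j / d`
  set Kb : ℕ := j / d with hKb
  have hdpos : 0 < d := by omega
  have hKb1 : 1 ≤ Kb := (Nat.le_div_iff_mul_le hdpos).2 (by simpa using hjd)
  have hKbj : d * Kb ≤ j := by rw [hKb, mul_comm]; exact Nat.div_mul_le_self j d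
  have hjd' : j ≤ d * Kb + d := by
    have := Nat.lt_div_mul_add hdpos (a := j); rw [hKb]; rw [mul_comm] at this; omega
  -- the coupling at the read-out rate
  set lam : ℝ := B * epsCoupling P U j with hlam
  have hε : 0 ≤ epsCoupling P U j := epsCoupling_nonneg' hKl U j
  have hεpos : 0 < epsCoupling P U j := by
    unfold epsCoupling; have : 0 < P.Klam := by linarith
    positivity
  have hlampos : 0 < lam := by rw [hlam]; positivity
  obtain ⟨hx₁, hx₂, hx₃, hy, hθ, hu₁, hu₂, hclose⟩ := hnum j hjd hjn
  -- caps for the blocks of this run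
  have hDk : ∀ k, 1 ≤ k → k ≤ Kb → Fintype.card (SpaceTimeIdx L M × SectorLeg (sectorCount (d * k - 1))) / 2 ≤ D :=
    fun k hk1 hk => hD k hk1 (le_trans (Nat.mul_le_mul_left d hk) (hKbj.trans hjn))
  -- (1) the weighted law at `(K_b, rate j)`
  have hL := hlaw' G P Q c hP hc hc6 hc₃a' μ hμ U hU hU9 hU₀a' hcU β hβmin hβc L M hL3 hM3 n hn1 hnN hkl hhist hosc hd Kb j hKb1 hKbj hjn D hD3 hDk
    A lam Q' Ab Qb hA hlampos hQ hAb hQb (Nb j) (hNb0 j) (hcar j hjd hjn) (hlawb j hjd hjn) hZd κb αb crb ccb hκb hαb hcrb hccb W Z σ τ ψ Φ hW hZ' hσ hτ hψ hΦ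
    A' Q'' hA'1 hQ'1 hA'2 hQ'2 hQ'0 (ι₁ j) ι₂ ι₃ (fun k hk1 hk => hι₁ j hjd hjn k hk1 (le_trans (Nat.mul_le_mul_left d hk) hKbj))
    (fun k hk1 hk => hι₂ j hjd hjn k hk1 (le_trans (Nat.mul_le_mul_left d hk) hKbj))
    (fun k hk1 hk => hι₃all j hjd hjn k hk1 (le_trans (Nat.mul_le_mul_left d hk) hKbj)) hx₁ hx₂ hx₃ hy hθ hu₁ hu₂ hclose
  obtain ⟨hZall, hlawKb, hrows⟩ := hL
  have hA'0 : 0 ≤ A' := le_trans (by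
    have hW0 : 0 ≤ W := by rw [hW]; have : 0 ≤ crb := le_trans (by positivity) hcrb; have : 0 ≤ ccb := le_trans (by positivity) hccb; positivity
    positivity) hA'2
  -- (2) the read-out fit at `(K_b, j)` in degrees `8 ≤ 2p ≤ 2D`
  have hF := hfit' G P Q c hP hc hc6 hc₃b' μ hμ U hU hU9 hU₀b' hcU β hβmin hβc L M hL3 hM3 n hn1 hnN hkl hhist hosc hd Kb j hKb1 hKbj hjn hjd' D hD3
    (hDk Kb hKb1 le_rfl) (hZall Kb hKb1 le_rfl) B A lam Q' Ab Qb hB rfl hA hlampos hQ hAb hQb (Nb j) (hNb0 j) (hcar j hjd hjn) (hlawb j hjd hjn) hlawKb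
    κb αb crb ccb hκbr hαbr hcrbr hccbr W Z σ τ ψ Φ hW hZ' hσ hτ hψ hΦ A' Q'' (ι₁ j) ι₂ ι₃ hA'0 hQ'0 (hrows Kb hKb1 le_rfl)
    (hι₁ j hjd hjn Kb hKb1 hKbj) (hι₂ j hjd hjn Kb hKb1 hKbj) (hι₃all j hjd hjn Kb hKb1 hKbj) hx₁ hx₂ hx₃ hy hθ (Atot j) (Qtot j) (hQtot j) (hAtot j) Qe
    (hCE j hjd hjn)
  -- (3) the degree split
  refine kernelNormsWt4_of_even hβ.ne' (fun m _ => klWtBudget_nonneg hCE0 hKl U j m) fun m hm hm2 q w => ?_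
  obtain ⟨p, rfl⟩ : ∃ p, m = 2 * p := by obtain ⟨r, hr⟩ := hm; exact ⟨r, by omega⟩
  rcases Nat.lt_or_ge p 4 with hp4 | hp4
  · -- `p ≤ 3`: `p = 0` has no pin, `p = 1` is carved, `p = 2, 3` are the cells
    interval_cases p
    · exact q.elim0
    · exact absurd rfl hm2
    · exact hcell4 j hjn q w
    · exact hcell6 j hjn q w
  · rcases Nat.lt_or_ge D p with hDp | hpD
    · -- above the cap: nilpotency
      rw [klWtPinnedSum_eq_zero_of_card_lt β U μ K j (by omega) q w]
      exact klWtBudget_nonneg hCE0 hKl U j _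
    · exact hF p hp4 hpD q w

end Summit.HubbardSuperconductivity.HubbardSuperconductivity.Theorems.EngineV8

end
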